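import Literature.MathematicalPhysics.QuantumFieldTheory.Balaban1983to89.Node00.TorusCoverCubeMemberRecordDentZd
import Literature.MathematicalPhysics.QuantumFieldTheory.Balaban1983to89.B15DeterminingSets
import HarnessLib

/-!
# N07 [B11] (= [15] = [Balaban1985Variational]) Sect. F ∕ [I] (0.1)–(0.3) — **POINTWISE VALUES TRANSCRIBE TO THE COVER WITH NO AVERAGING DICTIONARY**: the top-anchored lift
# `τ(x) := τ_T(π(x + c_k·𝟙))` of a torus gauge function reads the TORUS tower statement «`dist1 (τ_T(embIter t (iterBlockOf t w))⁻¹·τ_T(w)) ≤ ω·θ^{k−t}`» (this seat's p756047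
# `…N07TwoAxialTowersPointwiseOsc.dist1_descent_le_geom`) VERBATIM as the `ℤᵈ` hypothesis shape «`τ(L^{i+1}·z)⁻¹·τ(w_Z)`, `w_Z` under `z`» of ✓p753816 `B8ExpMeanLogOscFromPointwiseRec`

Cell `pub-ymgap`, width seat `pub-ymgap-dag-n07-w3` g13 (junction side of the K0 road; (σ2)).  `--kind proof --supports stmt-QuantumFields-20541 --as helper` (K0⁷; count-neutral; THEOREMS
ONLY, 0 `def`).  [I] = [Balaban1987RG1]; [6] = [Balaban1985RegularSpaces]; [15] = [Balaban1985Variational].  CONSUMED BY NAME: dag-n07-e's `Node00.TorusCoverLevels.{iterBlockOf_cover,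
embIter_coverAt}`, this seat's ✓p749305 `Node00.…RecordDentZd.blockMap_pow_add_ctrShift`, dag-n05-d's `B8Eq119TwistedAxialRec.{UnderZ, flmZ, underZ_iff_flmZ_eq, ctrShift_add}`,
r12's `B15DeterminingSets.embIter`, `B5Eq118OneStroke.iterBlockOf`.

WHY.  The junction's first cross-term factor is the LIFT of the torus transformation `τ_T = (h̄_s·w_s)·(h̄_r·w_r)⁻¹`; its pointwise multiscale oscillation is proved ON THE TORUS (p756047)
along the block tower `(embIter t (iterBlockOf t w))_t` of each fine site `w`, and consumed on `ℤᵈ` (✓p753816 ∕ ✓p755807) at the pairs `(L^{i+1}·z, w_Z)` with `w_Z` under `z`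
(`UnderZ L (i+1) z w_Z`).  THIS FILE is the dictionary between the two index systems for the anchored cover `x ↦ π(x + c_k·𝟙)`: the fine image of `w_Z` is `w := π(w_Z + c_k·𝟙)`, its
level-`(i+1)` block is `π_{i+1}(z + c_{k−(i+1)}·𝟙)` (`c_k = L^{i+1}·c_{k−(i+1)} + c_{i+1}`, `⌊(w_Z + c_{i+1})∕L^{i+1}⌋ = z`), whose centre is `π(L^{i+1}·z + c_k·𝟙)` — the fine image of
`L^{i+1}·z`.  Pure cover bookkeeping: NO guard, NO averaging.

WHAT IS PROVED (sorry-free; every `Params`, odd `L`; `i + 1 ≤ k ≤ m + K`).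
§1 `blockMap_add_smul_const` (`⌊(x + Q·b·𝟙)∕Q⌋ = ⌊x∕Q⌋ + b·𝟙`), ★★ `iterBlockOf_cover_anchor_eq_coverAt_add` (`iterBlockOf (i+1) (π(w_Z + c_k·𝟙)) = π_{i+1}(z + c_{k−(i+1)}·𝟙)` for `w_Z` under `z`),
   ★★ `embIter_iterBlockOf_cover_anchor` (`embIter (i+1) (iterBlockOf (i+1) (π(w_Z + c_k·𝟙))) = π(L^{i+1}·z + c_k·𝟙)`).
§2 ★★★ `pointwise_osc_lift_of_torus` — for any group-valued `τ_T` on the fine torus, any `S ⊆ T_η`, any bound `B : ℕ → ℝ`: the torus statement «`∀ t ≤ k, ∀ w ∈ S,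
   dist1 (τ_T(embIter t (iterBlockOf t w))⁻¹·τ_T(w)) ≤ B t`» gives, for `i < k`, every `z` and every `w_Z` under `z` with `π(w_Z + c_k·𝟙) ∈ S`:
   `dist1 (τ_T(π(L^{i+1}·z + c_k·𝟙))⁻¹·τ_T(π(w_Z + c_k·𝟙))) ≤ B (i+1)`.
HONEST FRAMING: count-neutral helper; cover bookkeeping only — nothing of [I]∕[6]∕[15] asserted or discharged; `NrmSymPhiOfRecord` ∕ `HThm4RecSym152PhiE(G)` ∕ `HThm4Rec*` UNDISCHARGED;
N05 ∕ N07 NOT discharged; K0⁷ ∕ K1⁹ NOT closed; counts unmoved (typed 28∕28 · discharged 8∕28); one finite 𝕋⁴ programme at fixed ε — R4 closes the conditional finite-𝕋⁴ rung `BalabanLadder.UV`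
only; the YM mass gap (Clay) is NOT proved by any of this; nothing continuum ∕ ℝ⁴ ∕ OS.  No `def`, no `instance`, no `notation`, no `sorry`.

References: [I] (0.1) p. 251, (0.3) p. 252; [6] (1.3)–(1.4) p. 77, (1.19) p. 79; [15] (147) p. 301.
-/

set_option autoImplicit false

noncomputable section

namespace Summit.QuantumFields.YangMills.BalabanUVNodes.N07TowerCentresCoverPointwise

open Literature.MathematicalPhysics.QuantumFieldTheory.Balaban1983to89
open Literature.MathematicalPhysics.QuantumFieldTheory.Balaban1983to89.Node00
open Literature.MathematicalPhysics.QuantumLattice (blockMap)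
open BlockAveragingZd (ctrShift)
open B8Eq119TwistedAxialRec (UnderZ flmZ underZ_iff_flmZ_eq ctrShift_add)
open B15Eq112TorusCover (cover)
open B14DomainGeom (Pt)
open B5Eq118OneStroke (iterBlockOf)
open B15DeterminingSets (embIter)

variable {P : Params}

/-! ## §1  The block and the centre of an anchored lift point -/

/-- `⌊(x + Q·b·𝟙)∕Q⌋ = ⌊x∕Q⌋ + b·𝟙` for `Q > 0`. [folklore] -/
theorem blockMap_add_smul_const (Q : ℕ) (hQ : 0 < Q) (x : Pt P.d) (b : ℤ) :
    blockMap Q (x + fun _ => (Q : ℤ) * b) = blockMap Q x + fun _ => b := by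
  funext i
  show (x i + (Q : ℤ) * b) / (Q : ℤ) = x i / (Q : ℤ) + b
  rw [mul_comm, Int.add_mul_ediv_right _ _ (by exact_mod_cast hQ.ne')]

/-- ★★ **THE LEVEL-`(i+1)` BLOCK OF THE ANCHORED FINE IMAGE OF A POINT UNDER `z`**: for `w_Z` under `z` at depth `i + 1` and `i + 1 ≤ k ≤ m + K`,
`iterBlockOf (i+1) (π(w_Z + c_k·𝟙)) = π_{i+1}(z + c_{k−(i+1)}·𝟙)` (`c_k = L^{i+1}·c_{k−(i+1)} + c_{i+1}`, odd `L`). [cite: Balaban1987RG1, (0.1) p.251, (0.3) p.252; Balaban1985RegularSpaces, (1.19) p.79] -/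
theorem iterBlockOf_cover_anchor_eq_coverAt_add {k i : ℕ} (hk : k ≤ P.m + P.K) (hik : i + 1 ≤ k) {z w : Pt P.d} (hw : UnderZ P.L (i + 1) z w) :
    iterBlockOf (i + 1) (cover P (w + fun _ => ((ctrShift P.L k : ℕ) : ℤ))) =
      coverAt P (i + 1) (z + fun _ => ((ctrShift P.L (k - (i + 1)) : ℕ) : ℤ)) := by
  rw [iterBlockOf_cover (hik.trans hk)]
  congr 1
  -- split the anchor: `c_k = L^{i+1}·c_{k−(i+1)} + c_{i+1}`
  have hc : (ctrShift P.L k : ℤ) = (P.L : ℤ) ^ (i + 1) * ctrShift P.L (k - (i + 1)) + ctrShift P.L (i + 1) := by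
    have h := ctrShift_add P.hL.1 (k - (i + 1)) (i + 1)
    rwa [Nat.sub_add_cancel hik] at h
  have hsplit : (w + fun _ => ((ctrShift P.L k : ℕ) : ℤ)) =
      (w + fun _ => ((ctrShift P.L (i + 1) : ℕ) : ℤ)) + fun _ => ((P.L ^ (i + 1) : ℕ) : ℤ) * (ctrShift P.L (k - (i + 1)) : ℤ) := by
    funext μ
    simp only [Pi.add_apply, hc]
    push_cast
    ring
  rw [hsplit, blockMap_add_smul_const (P.L ^ (i + 1)) (pow_pos P.L_pos _), blockMap_pow_add_ctrShift, (underZ_iff_flmZ_eq P.hL.1 (i + 1) z w).1 hw]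

/-- ★★ **THE CENTRE OF THAT BLOCK IS THE ANCHORED FINE IMAGE OF `L^{i+1}·z`**: `embIter (i+1) (iterBlockOf (i+1) (π(w_Z + c_k·𝟙))) = π(L^{i+1}·z + c_k·𝟙)`.
[cite: Balaban1987RG1, (0.1) p.251 («lattice of centers»), (0.3) p.252; Balaban1985RegularSpaces, (1.4) p.77] -/
theorem embIter_iterBlockOf_cover_anchor {k i : ℕ} (hk : k ≤ P.m + P.K) (hik : i + 1 ≤ k) {z w : Pt P.d} (hw : UnderZ P.L (i + 1) z w) :
    embIter (i + 1) (iterBlockOf (i + 1) (cover P (w + fun _ => ((ctrShift P.L k : ℕ) : ℤ)))) =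
      cover P ((((P.L : ℤ) ^ (i + 1)) • z) + fun _ => ((ctrShift P.L k : ℕ) : ℤ)) := by
  rw [iterBlockOf_cover_anchor_eq_coverAt_add hk hik hw, embIter_coverAt (hik.trans hk)]
  congr 1
  have hc : (ctrShift P.L k : ℤ) = (P.L : ℤ) ^ (i + 1) * ctrShift P.L (k - (i + 1)) + ctrShift P.L (i + 1) := by
    have h := ctrShift_add P.hL.1 (k - (i + 1)) (i + 1)
    rwa [Nat.sub_add_cancel hik] at h
  funext μ
  have e : (((P.L ^ (i + 1) - 1) / 2 : ℕ) : ℤ) = (ctrShift P.L (i + 1) : ℤ) := rfl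
  simp only [Pi.add_apply, Pi.smul_apply, smul_eq_mul]
  rw [e, hc]
  ring

/-! ## §2  The torus tower statement read on the cover -/

/-- ★★★ **POINTWISE OSCILLATION: TORUS TOWER STATEMENT ⇒ `ℤᵈ` SHAPE** — for any group-valued function `τ_T` on the fine torus, any site set `S` and any bound `B`: if
`dist1 (τ_T(embIter t (iterBlockOf t w))⁻¹·τ_T(w)) ≤ B t` for all `t ≤ k` and `w ∈ S`, then for every `i < k`, every `z` and every `w_Z` under `z` at depth `i + 1` whose anchored
image `π(w_Z + c_k·𝟙)` lies in `S`: `dist1 (τ_T(π(L^{i+1}·z + c_k·𝟙))⁻¹·τ_T(π(w_Z + c_k·𝟙))) ≤ B (i+1)` — the lift `τ := τ_T ∘ π ∘ (· + c_k·𝟙)` satisfies ✓p753816's `hpt` row at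
`(z, w_Z)` whenever the torus bound is `ω·θ^{k−(i+1)}`. [cite: Balaban1987RG1, (0.1) p.251, (0.3) p.252; Balaban1985RegularSpaces, (1.19) p.79; Balaban1985Variational, (147) p.301] -/
theorem pointwise_osc_lift_of_torus {G : Type*} [GaugeGroup G] {k : ℕ} (hk : k ≤ P.m + P.K) (τ : Site P 0 → G) (S : Set (Site P 0)) (B : ℕ → ℝ)
    (hT : ∀ t, t ≤ k → ∀ w ∈ S, dist1 ((τ (embIter t (iterBlockOf t w)))⁻¹ * τ w) ≤ B t)
    {i : ℕ} (hik : i < k) (z : Pt P.d) {w : Pt P.d} (hw : UnderZ P.L (i + 1) z w)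
    (hS : cover P (w + fun _ => ((ctrShift P.L k : ℕ) : ℤ)) ∈ S) :
    dist1 ((τ (cover P ((((P.L : ℤ) ^ (i + 1)) • z) + fun _ => ((ctrShift P.L k : ℕ) : ℤ))))⁻¹ *
        τ (cover P (w + fun _ => ((ctrShift P.L k : ℕ) : ℤ)))) ≤ B (i + 1) := by
  have h := hT (i + 1) hik _ hS
  rwa [embIter_iterBlockOf_cover_anchor hk hik hw] at h

end Summit.QuantumFields.YangMills.BalabanUVNodes.N07TowerCentresCoverPointwise

end
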